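import Mathlib
import Summits.MatrixMultiplication.MatrixMultiplication.Theses.FidelityWitnesses
import Summits.MatrixMultiplication.MatrixMultiplication.Theorems.SevenEighthsLaw.Negative.SharpConstants
import Literature.Computability.AlgebraicComplexity.BorderRankMatMulTwoHolds

/-!
# `FidelityWitnesses.LinearDefectLaw` (stmt-MatrixMultiplication-14039) — Negative lane:
# the `n = 2` rungs, their sharpness, and what a disproof must be

Negative / support lemmas of the standing disprover (`Cruxes/LinearDefectLaw/Disproof.lean`), landed
for import by ideators, planners and the line lead.  No Theses statement is asserted positively here.
The crux says `|⟨S,⟨n,n,n⟩⟩|² ≤ (n³ + r − R̲(⟨n,n,n⟩))·‖S‖²` for every complex `S` of rank `≤ r`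
("Frobenius error buys border rank no cheaper than deleting unit products").

* `linearDefectLaw_two` — with the tree's `R̲(⟨2,2,2⟩) = 7` the law reads `M(2,r) ≤ r + 1`, the only
  instances decidable in the tree today (at `n = 3` only `15 ≤ R̲` is proved).
* `linearDefectLaw_not_of_int` — **kill switch**: an INTEGER tensor with an integer rank-`≤ r`
  certificate and `(r+1)·Σ Sz² < (Σ Sz·⟨2,2,2⟩)²` refutes the crux (base change `ℤ → ℂ`, reusing
  `SevenEighthsLawNeg.violates_of_int`-style transfer).
* `linearDefectLaw_false_without_rank`, `linearDefectLaw_not_slack` — the rank hypothesis is the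
  whole content (`S = ⟨2,2,2⟩`, `r = 0`: `64 > 8`), and no uniform extra slack `δ > 0` survives
  (`(2,6)`: the honest rank-6 tensor `⟨2,2,2⟩ − a₂₂ b₂₂ c₂₂` gives equality `49 = 7·7`,
  `linearDefectLaw_tight_two_six`).
* `LinearDefectLawNeg.bini5S m = m·M^red + C₂` — Bini's five products at `ε = 1/m`, denominators
  cleared: honest rank `≤ 5`, overlap `6m`, squared norm `6m² + 4`; hence the `(2,5)` bound `6` is
  sharp (`linearDefectLaw_tight_two_five`, `linearDefectLaw_not_two_five_strengthened`), is approached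
  from BELOW (`bini5S_ratio_lt_six`), its limit `M^red` has ratio exactly `6` (`MredZ_vals`), and
  fidelity is already super-additive at rank 5 (`linearDefectLaw_not_additive_at_five`: `144 > 140`).
-/

namespace Summit.MatrixMultiplication.MatrixMultiplication.Theorems

open scoped BigOperators
open Literature.Computability.AlgebraicComplexity
open Summit.MatrixMultiplication.MatrixMultiplication.Theses.FidelityWitnesses (LinearDefectLaw)
open SevenEighthsLawNeg

/-- **The `n = 2` rungs.** `LinearDefectLaw` specialises, via the tree theorem
`algBorderRank_matMulTensor_two : R̲(⟨2,2,2⟩) = 7`, to `M(2,r) ≤ r + 1`: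
`|⟨S,⟨2,2,2⟩⟩|² ≤ (r + 1)·‖S‖²` for every `S` of rank `≤ r`. [folklore] -/
theorem linearDefectLaw_two (h : LinearDefectLaw) (r : ℕ) (S : P2 → P2 → P2 → ℂ)
    (hS : tensorRank S ≤ r) :
    ‖∑ a, ∑ b, ∑ c, S a b c * matMulTensor ℂ 2 2 2 a b c‖ ^ 2 ≤
      ((r : ℝ) + 1) * ∑ a, ∑ b, ∑ c, ‖S a b c‖ ^ 2 := by
  have key := h 2 r S hS
  rw [algBorderRank_matMulTensor_two ℂ] at key
  have e : ((2 : ℕ) : ℝ) ^ 3 + (r : ℝ) - ((7 : ℕ) : ℝ) = (r : ℝ) + 1 := by push_cast; ring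
  rw [e] at key
  exact key

/-- **Kill switch (integer form).** An integer tensor with an integer rank-`≤ r` certificate and
`(r+1)·Σ Sz² < (Σ Sz·⟨2,2,2⟩)²` (both `decide`-able) refutes `LinearDefectLaw`; by homogeneity every
counterexample at `n = 2` with rational (or Gaussian) data reduces to this shape. [folklore] -/
theorem linearDefectLaw_not_of_int (r : ℕ) (Sz : P2 → P2 → P2 → ℤ) (hr : tensorRank Sz ≤ r)
    (h : ((r : ℤ) + 1) * normSqZ Sz < overlapZ Sz ^ 2) : ¬ LinearDefectLaw := by
  intro hlaw
  have key := linearDefectLaw_two hlaw r (castT Sz) ((tensorRank_castT_le Sz).trans hr)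
  rw [(ratio_castT Sz).1, (ratio_castT Sz).2] at key
  have h' : (((r : ℤ) + 1) * normSqZ Sz : ℝ) < ((overlapZ Sz ^ 2 : ℤ) : ℝ) := by exact_mod_cast h
  push_cast at key h'
  linarith

/-- **Any proof must use the rank bound**: with the hypothesis `tensorRank S ≤ r` dropped the law is
false — `n = 2`, `r = 0`, `S = ⟨2,2,2⟩` reads `64 ≤ (8 + 0 − 7)·8`. [folklore] -/
theorem linearDefectLaw_false_without_rank :
    ¬ ∀ n r : ℕ, ∀ S : Fin n × Fin n → Fin n × Fin n → Fin n × Fin n → ℂ,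
      ‖∑ a, ∑ b, ∑ c, S a b c * matMulTensor ℂ n n n a b c‖ ^ 2 ≤
        ((n : ℝ) ^ 3 + (r : ℝ) - (algBorderRank (matMulTensor ℂ n n n) : ℝ)) *
          ∑ a, ∑ b, ∑ c, ‖S a b c‖ ^ 2 := by
  intro h
  have key := h 2 0 (castT (matMulTensor ℤ 2 2 2))
  rw [(ratio_castT _).1, (ratio_castT _).2, overlapZ_matMul, normSqZ_matMul,
    algBorderRank_matMulTensor_two ℂ] at key
  norm_num at key

/-- **`(2,6)` is tight and ATTAINED**: the honest rank-6 integer tensor `⟨2,2,2⟩ − a₂₂⊗b₂₂⊗c₂₂`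
(`SevenEighthsLawNeg.sixS`, six transported Strassen products) has `‖S‖² = 7` and
`|⟨S,T⟩|² = 49 = (6 + 1)·‖S‖²` — equality in the `(2,6)` rung of the law. [cite: Strassen1969] -/
theorem linearDefectLaw_tight_two_six : ∃ S : P2 → P2 → P2 → ℂ, tensorRank S ≤ 6 ∧
    (∑ a, ∑ b, ∑ c, ‖S a b c‖ ^ 2) = 7 ∧
    ‖∑ a, ∑ b, ∑ c, S a b c * matMulTensor ℂ 2 2 2 a b c‖ ^ 2 =
      ((6 : ℝ) + 1) * ∑ a, ∑ b, ∑ c, ‖S a b c‖ ^ 2 := by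
  refine ⟨castT sixS, (tensorRank_castT_le _).trans tensorRank_sixS_le, ?_, ?_⟩
  · rw [(ratio_castT _).2, sixS_vals.2]; push_cast; ring
  · rw [(ratio_castT _).1, (ratio_castT _).2, sixS_vals.1, sixS_vals.2]; push_cast; norm_num

/-- **No uniform extra slack**: for every `δ > 0` the strengthened law
`|⟨S,T⟩|² ≤ (n³ + r − R̲ − δ)·‖S‖²` is false (at `(2,6)`: `49 > (7 − δ)·7`). [folklore] -/
theorem linearDefectLaw_not_slack (δ : ℝ) (hδ : 0 < δ) :
    ¬ ∀ n r : ℕ, ∀ S : Fin n × Fin n → Fin n × Fin n → Fin n × Fin n → ℂ, tensorRank S ≤ r →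
      ‖∑ a, ∑ b, ∑ c, S a b c * matMulTensor ℂ n n n a b c‖ ^ 2 ≤
        ((n : ℝ) ^ 3 + (r : ℝ) - (algBorderRank (matMulTensor ℂ n n n) : ℝ) - δ) *
          ∑ a, ∑ b, ∑ c, ‖S a b c‖ ^ 2 := by
  intro h
  have key := h 2 6 (castT sixS) ((tensorRank_castT_le _).trans tensorRank_sixS_le)
  rw [(ratio_castT _).1, (ratio_castT _).2, sixS_vals.1, sixS_vals.2,
    algBorderRank_matMulTensor_two ℂ] at key
  norm_num at key
  linarith

namespace LinearDefectLawNeg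

/-- Z-slot factors (output side, `c_{ki} ↦ position (i,k)`) of Bini's FIVE products at `ε = 1/m`,
denominators cleared (Landsberg 2017, (2.1.2); = `SevenEighthsLawNeg.biniW` without its honest sixth
term). [cite: Landsberg2017, (2.1.2)] -/
def bini5W (m : ℤ) : Fin 5 → P2 → ℤ :=
  ![e 0 1, m • e 0 0 + e 1 0, m • e 0 0 + m • e 0 1 + e 1 1, e 0 0, m • e 0 0 + e 1 1]

/-- X-slot factors (`a_{ij}`): `(m a₁₂ + a₁₁), (m a₂₁ + a₁₁), −m a₁₂, −m a₂₁, a₁₂ + a₂₁`.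
[cite: Landsberg2017, (2.1.2)] -/
def bini5U (m : ℤ) : Fin 5 → P2 → ℤ :=
  ![m • e 0 1 + e 0 0, m • e 1 0 + e 0 0, -(m • e 0 1), -(m • e 1 0), e 0 1 + e 1 0]

/-- Y-slot factors (`b_{jk}`): `(m b₁₂ + b₂₂), b₁₁, b₁₂, (m b₁₁ + m b₁₂ + b₂₁), (m b₁₂ + b₂₁)`.
[cite: Landsberg2017, (2.1.2)] -/
def bini5V (m : ℤ) : Fin 5 → P2 → ℤ :=
  ![m • e 0 1 + e 1 1, e 0 0, e 0 1, m • e 0 0 + m • e 0 1 + e 1 0, m • e 0 1 + e 1 0]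

/-- `bini5S m = Σ_{r<5} bini5W m r ⊗ bini5U m r ⊗ bini5V m r` (`= m·M^red + C₂`), an HONEST
rank-`≤ 5` integer tensor for every `m`. [cite: Landsberg2017, (2.1.2)] -/
def bini5S (m : ℤ) : P2 → P2 → P2 → ℤ := fun a b c => ∑ r, bini5W m r a * bini5U m r b * bini5V m r c

/-- The integer rank certificate `R(bini5S m) ≤ 5`. [cite: Landsberg2017, (2.1.2)] -/
theorem tensorRank_bini5S_le (m : ℤ) : tensorRank (bini5S m) ≤ 5 :=
  tensorRank_le_of_eq_sum (bini5W m) (bini5U m) (bini5V m)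
    (by funext a b c; simp [bini5S, Finset.sum_apply, triad_apply])

/-- Overlap `⟨bini5S m, ⟨2,2,2⟩⟩ = 6m`. [cite: Landsberg2017, (2.1.2)] -/
theorem overlapZ_bini5S (m : ℤ) : overlapZ (bini5S m) = 6 * m := by
  simp [overlapZ, bini5S, bini5W, bini5U, bini5V, e, matMulTensor, Fintype.sum_prod_type,
    Fin.sum_univ_succ]
  ring

/-- Squared norm `‖bini5S m‖² = 6m² + 4`. [cite: Landsberg2017, (2.1.2)] -/
theorem normSqZ_bini5S (m : ℤ) : normSqZ (bini5S m) = 6 * m ^ 2 + 4 := by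
  simp [normSqZ, bini5S, bini5W, bini5U, bini5V, e, Fintype.sum_prod_type, Fin.sum_univ_succ]
  ring

/-- The Bini family approaches the `(2,5)` bound `6` strictly from BELOW: `(6m)² < 6·(6m² + 4)`.
[cite: Landsberg2017, (2.1.2)] -/
theorem bini5S_ratio_lt_six (m : ℤ) : overlapZ (bini5S m) ^ 2 < 6 * normSqZ (bini5S m) := by
  rw [overlapZ_bini5S, normSqZ_bini5S]; nlinarith [sq_nonneg m]

/-- The border limit point `M^red = ⟨2,2,2⟩ ∖ {a₂₂ b₂₁, a₂₂ b₂₂}` (Bini's tensor: border rank 5,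
rank 6) as an integer tensor in the tree's slot order `(Z, X, Y)`. [cite: Landsberg2017, §2.1.4] -/
def MredZ : P2 → P2 → P2 → ℤ := fun a b c =>
  if b = (1, 1) then 0 else matMulTensor ℤ 2 2 2 a b c

/-- `⟨M^red, T⟩ = ‖M^red‖² = 6`: ratio exactly `6 = 5 + 1`, the `(2,5)` bound, ON the border.
[cite: Landsberg2017, §2.1.4] -/
theorem MredZ_vals : overlapZ MredZ = 6 ∧ normSqZ MredZ = 6 := by decide

/-- `bini5S m = m·M^red + C₂` with `C₂ = bini5S 0` (`= x¹₁y²₂z²₁ + x¹₁y¹₁z¹₂ + (x¹₂+x²₁)y²₁z²₂`):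
the family is the secant of Bini's valley. [cite: Landsberg2017, (2.1.2)] -/
theorem bini5S_eq (m : ℤ) : bini5S m = fun a b c => m * MredZ a b c + bini5S 0 a b c := by
  funext a b c
  obtain ⟨a1, a2⟩ := a
  obtain ⟨b1, b2⟩ := b
  obtain ⟨c1, c2⟩ := c
  fin_cases a1 <;> fin_cases a2 <;> fin_cases b1 <;> fin_cases b2 <;> fin_cases c1 <;>
    fin_cases c2 <;>
    simp [bini5S, bini5W, bini5U, bini5V, e, MredZ, matMulTensor, Fin.sum_univ_succ]

/-- `C₂ ⟂ ⟨2,2,2⟩` and `‖C₂‖² = 4`. [cite: Landsberg2017, (2.1.2)] -/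
theorem C2_vals : overlapZ (bini5S 0) = 0 ∧ normSqZ (bini5S 0) = 4 := by decide

end LinearDefectLawNeg

open LinearDefectLawNeg

/-- The Bini family in the crux's own terms: honest rank `≤ 5`, `|⟨S,T⟩|² = 36m²`,
`‖S‖² = 6m² + 4`. [cite: Landsberg2017, (2.1.2)] -/
theorem linearDefectLaw_bini5Family (m : ℤ) : ∃ S : P2 → P2 → P2 → ℂ, tensorRank S ≤ 5 ∧
    ‖∑ a, ∑ b, ∑ c, S a b c * matMulTensor ℂ 2 2 2 a b c‖ ^ 2 = (6 * m) ^ 2 ∧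
    (∑ a, ∑ b, ∑ c, ‖S a b c‖ ^ 2) = 6 * m ^ 2 + 4 := by
  refine ⟨castT (bini5S m), (tensorRank_castT_le _).trans (tensorRank_bini5S_le m), ?_, ?_⟩
  · rw [(ratio_castT _).1, overlapZ_bini5S]; push_cast; ring
  · rw [(ratio_castT _).2, normSqZ_bini5S]; push_cast; ring

/-- **`(2,5)` is tight**: the constant `6 = 5 + 1` of the `(2,5)` rung (= support item
`SixEighthsAtFive`) cannot be lowered — for every `η > 0` some honest rank-`≤ 5` tensor has
`(6 − η)·‖S‖² < |⟨S,T⟩|²` (ratio `6 − 24/(6m² + 4)`). [cite: Landsberg2017, (2.1.2)] -/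
theorem linearDefectLaw_tight_two_five (η : ℝ) (hη : 0 < η) : ∃ S : P2 → P2 → P2 → ℂ,
    tensorRank S ≤ 5 ∧
    (6 - η) * ∑ a, ∑ b, ∑ c, ‖S a b c‖ ^ 2 <
      ‖∑ a, ∑ b, ∑ c, S a b c * matMulTensor ℂ 2 2 2 a b c‖ ^ 2 := by
  obtain ⟨m, hm⟩ := exists_nat_gt (24 / η)
  obtain ⟨S, hS, h1, h2⟩ := linearDefectLaw_bini5Family (m : ℤ)
  refine ⟨S, hS, ?_⟩
  rw [h1, h2]
  push_cast
  have hm0 : (0 : ℝ) ≤ m := Nat.cast_nonneg m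
  have h24 : 24 < η * m := by rwa [div_lt_iff₀ hη, mul_comm] at hm
  nlinarith [mul_nonneg hm0 hm0, sq_nonneg ((m : ℝ)), h24, hη]

/-- The strengthening `M(2,5) ≤ 6 − 1/100` of the `(2,5)` rung is FALSE. [cite: Landsberg2017, (2.1.2)] -/
theorem linearDefectLaw_not_two_five_strengthened : ¬ (∀ S : P2 → P2 → P2 → ℂ, tensorRank S ≤ 5 →
    ‖∑ a, ∑ b, ∑ c, S a b c * matMulTensor ℂ 2 2 2 a b c‖ ^ 2 ≤
      (6 - 1 / 100) * ∑ a, ∑ b, ∑ c, ‖S a b c‖ ^ 2) := by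
  intro h
  obtain ⟨S, hS, hlt⟩ := linearDefectLaw_tight_two_five (1 / 100) (by norm_num)
  exact absurd (h S hS) (not_le.mpr hlt)

/-- **Fidelity is NOT additive at rank 5**: `M(2,5) ≤ 5` ("five multiplications capture at most five
of the eight units") fails — `bini5S 2` has `⟨S,T⟩² = 144 > 140 = 5·‖S‖²`. [cite: Landsberg2017, (2.1.2)] -/
theorem linearDefectLaw_not_additive_at_five :
    ¬ ∀ S : P2 → P2 → P2 → ℂ, tensorRank S ≤ 5 →
      ‖∑ a, ∑ b, ∑ c, S a b c * matMulTensor ℂ 2 2 2 a b c‖ ^ 2 ≤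
        5 * ∑ a, ∑ b, ∑ c, ‖S a b c‖ ^ 2 := by
  intro h
  have key := h (castT (bini5S 2)) ((tensorRank_castT_le _).trans (tensorRank_bini5S_le 2))
  rw [(ratio_castT _).1, (ratio_castT _).2, overlapZ_bini5S, normSqZ_bini5S] at key
  norm_num at key

end Summit.MatrixMultiplication.MatrixMultiplication.Theorems
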